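import Summits.AtomisticToContinuum.Crystallization.Theses.ChessboardParticlePlanes
import Summits.AtomisticToContinuum.Crystallization.Theorems.ChessboardParticlePlanesLjPlaneChessboardReduction
import Summits.AtomisticToContinuum.Crystallization.Theorems.ChessboardParticlePlanesLjPlaneChessboardHorizontalBasis
import Summits.AtomisticToContinuum.Crystallization.Theorems.ChessboardParticlePlanesLjPlaneChessboardVerticalPeriod
import Summits.AtomisticToContinuum.Crystallization.Theorems.ChessboardParticlePlanesLjPlaneChessboardHeightEnumeration
import Summits.AtomisticToContinuum.Crystallization.Theorems.ChessboardParticlePlanesLjPlaneChessboardLayerPresentation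
import Summits.AtomisticToContinuum.Crystallization.Theorems.ChessboardParticlePlanesLjPlaneChessboardPlanarLattice
import Summits.AtomisticToContinuum.Crystallization.Theorems.ChessboardParticlePlanesLjPlaneChessboardMotifToLayers
import Summits.AtomisticToContinuum.Crystallization.Theorems.ChessboardParticlePlanesLjPlaneChessboardDeficitKernel
import Summits.AtomisticToContinuum.Crystallization.Theorems.ChessboardParticlePlanesLjPlaneChessboardSliceIdentity
import Summits.AtomisticToContinuum.Crystallization.Theorems.ChessboardParticlePlanesLjPlaneChessboardCrossKernelFourier
import Literature.Algebra.EuclideanLattices.DualLattice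

/-!
# Crux `LjPlaneChessboard` (stmt-AtomisticToContinuum-6709) — GLUE of the route-level split (crux-strategist s2, 2026-08-17)

Sorry-free implication  `KernelModeSliceForm → SharpBlockReduction → SharpBlockCore → LjPlaneChessboard`  for
`ledger route edit route-AtomisticToContinuum-ChessboardParticlePlanes --split LjPlaneChessboard --glue-by …ljPlaneChessboard_of_subs`.

Cut = strategist s1's line `twolayer-margin` v3 (`Cruxes/LjPlaneChessboard/Lines/twolayer_margin.lean`: exact slice SOS ⇒ exact block
relation `M_i = N_i + ρ_i M_{i+1}` ⇒ one three-layer block core) with ONE CORRECTION found by s2's numerics (kit j026513/j026550/j026573):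
s1's typed core dropped all slices `λ ≤ 3` and deformed the rest by `4e^{-3λ/4}`; that makes the `w = 0` channel of the block form NON-PSD on the
density simplex for nearly-equal small gaps (min `nᵀK(0)n / nᵀK⁺(0)n = -1.09` at `(c₁,c₂) = (0.75,0.8)`, `n = (0.11,0.74,0.15)`), although the
undeformed block form is coercive there (`+0.51`).  The SHARP core below keeps every slice `λ > 1/2` and deforms it by EXACTLY the two-sided
`ℓ²` bound of the block relation — `W/(1+ρ̄)²` on positive slices, `W/(1-ρ̄)²` on negative ones, `ρ̄(λ) = e^{-3λ/4}/√(1-e^{-3λ/2})` — which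
restores `w = 0` coercivity (`+0.455`) and is pointwise WEAKER than s1's core (hence more likely true, and still sufficient).

* `KernelModeSliceForm` (sub A, identity, M): the motif-summed chessboard deficit in kernel form (conclusion of the lead's registered stub
  `stub_kernelFormNonneg`, skeleton v9) EQUALS `4π/covol(L) · Σ'_{w∈L*} ∫_{λ>2π‖w‖} W(2π‖w‖,λ)·LHS_w(λ) dλ` (text = s1's `stub_modeSliceForm`).
* `SharpBlockReduction` (sub B, M/L): the sharp block core implies `0 ≤ Σ'_w ∫ W·LHS_w` for every admissible layered presentation
  (slice identity p105431 + block relation + `‖R‖ ≤ ρ̄(λ) < 1` for `λ > 1/2` ⇒ `W‖M‖² ≥ [W⁺(1+ρ̄)⁻² − W⁻(1−ρ̄)⁻²]‖N‖²` slice by slice).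
* `SharpBlockCore` (sub C, XL, the analytic core): the sharp-deformed mode/slice form of the block mismatch of three `2/3`-separated
  `L`-periodic layers with gaps `c₁, c₂ ≥ 3/4` is `≥ 0`.

The proof is the lead's v9 bookkeeping verbatim over landed lemmas and the landed reduction `stub_reduction` (p113745).
[cite: GiulianiLebowitzLieb2008, Lemma 1; FrohlichEtAl1978, Thm 3.1]
-/

noncomputable section

namespace Summit.AtomisticToContinuum.Crystallization.Theorems.ChessboardParticlePlanesLjPlaneChessboard

open Literature.MathematicalPhysics.StatisticalMechanics
open Literature.Algebra.EuclideanLattices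
open scoped Real InnerProductSpace FourierTransform

/-! ### The three subs as section hypotheses (texts character-identical to the children of the split) -/

section Subs

variable
    (hA :
      ∀ (Q : PeriodicConfiguration 3) (τu τd : ℝ → ℝ) (a b g₀ : EuclideanSpace ℝ (Fin 3))
      (z : ℤ → ℝ) (n : ℕ) (F : ℤ → Finset (EuclideanSpace ℝ (Fin 3)))
      (L : Submodule ℤ (EuclideanSpace ℝ (Fin 2))) [DiscreteTopology L] [IsZLattice ℝ L],
      (∀ x ∈ Q.points, ∀ y ∈ Q.points, x ≠ y → (2 : ℝ) / 3 ≤ dist x y) →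
      (∀ x' ∈ Q.points, ∀ y ∈ Q.points, x' 2 ≠ y 2 → (3 : ℝ) / 4 ≤ |x' 2 - y 2|) →
      (∀ t : ℝ, (∃ x ∈ Q.points, x 2 = t) →
      (t < τu t ∧ (∃ x ∈ Q.points, x 2 = τu t) ∧ (∀ x ∈ Q.points, x 2 ≤ t ∨ τu t ≤ x 2)) ∧
      (τd t < t ∧ (∃ x ∈ Q.points, x 2 = τd t) ∧ (∀ x ∈ Q.points, x 2 ≤ τd t ∨ t ≤ x 2))) →
      a ∈ Q.lattice → b ∈ Q.lattice → a 2 = 0 → b 2 = 0 → LinearIndependent ℝ ![a, b] →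
      (∀ g ∈ Q.lattice, g 2 = 0 → ∃ k l : ℤ, g = (k : ℝ) • a + (l : ℝ) • b) →
      (∀ v : EuclideanSpace ℝ (Fin 2),
      v ∈ L ↔ ∃ k l : ℤ, v = (k : ℝ) • !₂[a 0, a 1] + (l : ℝ) • !₂[b 0, b 1]) →
      g₀ ∈ Q.lattice → 0 < n → StrictMono z → (∀ i : ℤ, z (i + n) = z i + g₀ 2) →
      (∀ g ∈ Q.lattice, ∃ k : ℤ, g 2 = g₀ 2 * k) →
      (∀ y ∈ Q.points, ∃ i : ℤ, y 2 = z i) → (∀ i : ℤ, ∃ y ∈ Q.points, y 2 = z i) →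
      (∀ i : ℤ, z (i + 1) = τu (z i)) → (∀ i : ℤ, τd (z (i + 1)) = z i) →
      (∀ m : ℤ, ∀ f ∈ F m, f 2 = z m ∧ f ∈ Q.points) →
      (∀ m : ℤ, ∀ f ∈ F m, ∀ f' ∈ F m, f ≠ f' → ∀ k l : ℤ, f' ≠ f + (k : ℝ) • a + (l : ℝ) • b) →
      (∀ (m : ℤ) (y : EuclideanSpace ℝ (Fin 3)),
      (y ∈ Q.points ∧ y 2 = z m) ↔ ∃ f ∈ F m, ∃ k l : ℤ, y = f + (k : ℝ) • a + (l : ℝ) • b) →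
      (∀ m : ℤ, F (m + n) = (F m).image (fun f => f + g₀)) →
      ∑ i₀ ∈ Finset.range n, ∑ x ∈ F i₀,
      ∑ m ∈ Finset.range n, ∑ f' ∈ F m, ∑' v : L,
      ∑' j : ℤ,
      ((if (m : ℤ) + j * n = (i₀ : ℤ) then 0 else
      2 * lennardJones (Real.sqrt
      (‖!₂[x 0, x 1] - !₂[f' 0, f' 1] - (j : ℝ) • !₂[g₀ 0, g₀ 1]
      - (v : EuclideanSpace ℝ (Fin 2))‖ ^ 2 + (z (i₀ : ℤ) - z ((m : ℤ) + j * n)) ^ 2)))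
      - (if (m : ℤ) + j * n = (i₀ : ℤ) then
      ∑' k : {k : ℤ // k ≠ 0},
      (lennardJones (Real.sqrt
      (‖!₂[x 0, x 1] - !₂[f' 0, f' 1] - (v : EuclideanSpace ℝ (Fin 2))‖ ^ 2
      + (2 * |(k : ℝ)| * (z ((i₀ : ℤ) + 1) - z (i₀ : ℤ))) ^ 2)) +
      lennardJones (Real.sqrt
      (‖!₂[x 0, x 1] - !₂[f' 0, f' 1] - (v : EuclideanSpace ℝ (Fin 2))‖ ^ 2
      + (2 * |(k : ℝ)| * (z (i₀ : ℤ) - z ((i₀ : ℤ) - 1))) ^ 2)))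
      else 0)
      - (if (m : ℤ) + j * n = (i₀ : ℤ) + 1 then
      ∑' k : ℤ, lennardJones (Real.sqrt
      (‖!₂[x 0, x 1] - !₂[f' 0, f' 1] - (j : ℝ) • !₂[g₀ 0, g₀ 1]
      - (v : EuclideanSpace ℝ (Fin 2))‖ ^ 2
      + (|2 * (k : ℝ) + 1| * (z ((i₀ : ℤ) + 1) - z (i₀ : ℤ))) ^ 2))
      else 0)
      - (if (m : ℤ) + j * n = (i₀ : ℤ) - 1 then
      ∑' k : ℤ, lennardJones (Real.sqrt
      (‖!₂[x 0, x 1] - !₂[f' 0, f' 1] - (j : ℝ) • !₂[g₀ 0, g₀ 1]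
      - (v : EuclideanSpace ℝ (Fin 2))‖ ^ 2
      + (|2 * (k : ℝ) + 1| * (z (i₀ : ℤ) - z ((i₀ : ℤ) - 1))) ^ 2))
      else 0))
      = 4 * π / ZLattice.covolume L *
      ∑' w : dualLattice L, ∫ l in Set.Ioi (2 * π * ‖(w : EuclideanSpace ℝ (Fin 2))‖),
      ((l ^ 2 - (2 * π * ‖(w : EuclideanSpace ℝ (Fin 2))‖) ^ 2) * Real.sqrt (l ^ 2 - (2 * π * ‖(w : EuclideanSpace ℝ (Fin 2))‖) ^ 2) / 144 - (l ^ 2 - (2 * π * ‖(w : EuclideanSpace ℝ (Fin 2))‖) ^ 2) ^ 4 * Real.sqrt (l ^ 2 - (2 * π * ‖(w : EuclideanSpace ℝ (Fin 2))‖) ^ 2) / 43545600)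
      * ∑ i ∈ Finset.range n,
      ((2 * ((∑ f ∈ F ((i : ℤ)), Complex.exp (2 * π * Complex.I * (⟪(!₂[f 0, f 1] : EuclideanSpace ℝ (Fin 2)), (w : EuclideanSpace ℝ (Fin 2))⟫_ℝ : ℂ))) * starRingEnd ℂ (∑ f ∈ F ((i : ℤ) + 1), Complex.exp (2 * π * Complex.I * (⟪(!₂[f 0, f 1] : EuclideanSpace ℝ (Fin 2)), (w : EuclideanSpace ℝ (Fin 2))⟫_ℝ : ℂ)))).re
      * Real.exp (-(l * (z (((i : ℤ)) + 1) - z ((i : ℤ)))))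
      + (‖(∑ f ∈ F ((i : ℤ)), Complex.exp (2 * π * Complex.I * (⟪(!₂[f 0, f 1] : EuclideanSpace ℝ (Fin 2)), (w : EuclideanSpace ℝ (Fin 2))⟫_ℝ : ℂ)))‖ ^ 2 + ‖(∑ f ∈ F ((i : ℤ) + 1), Complex.exp (2 * π * Complex.I * (⟪(!₂[f 0, f 1] : EuclideanSpace ℝ (Fin 2)), (w : EuclideanSpace ℝ (Fin 2))⟫_ℝ : ℂ)))‖ ^ 2)
      * Real.exp (-(2 * (l * (z (((i : ℤ)) + 1) - z ((i : ℤ)))))))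
      / (1 - Real.exp (-(2 * (l * (z (((i : ℤ)) + 1) - z ((i : ℤ)))))))
      - 2 * ((∑ f ∈ F ((i : ℤ)), Complex.exp (2 * π * Complex.I * (⟪(!₂[f 0, f 1] : EuclideanSpace ℝ (Fin 2)), (w : EuclideanSpace ℝ (Fin 2))⟫_ℝ : ℂ))) * starRingEnd ℂ
      (∑' k : ℕ, (Real.exp (-(l * (z ((i : ℤ) + 1 + k) - z (i : ℤ)))) : ℂ)
      * (∑ f ∈ F ((i : ℤ) + 1 + (k : ℤ)), Complex.exp (2 * π * Complex.I * (⟪(!₂[f 0, f 1] : EuclideanSpace ℝ (Fin 2)), (w : EuclideanSpace ℝ (Fin 2))⟫_ℝ : ℂ))))).re))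
    (hB :
      (∀ (L : Submodule ℤ (EuclideanSpace ℝ (Fin 2))) [DiscreteTopology L] [IsZLattice ℝ L]
      (F₀ F₁ F₂ : Finset (EuclideanSpace ℝ (Fin 2))) (c₁ c₂ : ℝ),
      (∀ f ∈ F₀, ∀ f' ∈ F₀, ∀ v ∈ L, f ≠ f' + v → (2 : ℝ) / 3 ≤ dist f (f' + v)) →
      (∀ f ∈ F₁, ∀ f' ∈ F₁, ∀ v ∈ L, f ≠ f' + v → (2 : ℝ) / 3 ≤ dist f (f' + v)) →
      (∀ f ∈ F₂, ∀ f' ∈ F₂, ∀ v ∈ L, f ≠ f' + v → (2 : ℝ) / 3 ≤ dist f (f' + v)) →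
      (3 : ℝ) / 4 ≤ c₁ → (3 : ℝ) / 4 ≤ c₂ →
      0 ≤ (∑' w : dualLattice L, ∫ l in Set.Ioi (max (2 * π * ‖(w : EuclideanSpace ℝ (Fin 2))‖) (1 / 2 : ℝ)),
      (max ((l ^ 2 - (2 * π * ‖(w : EuclideanSpace ℝ (Fin 2))‖) ^ 2) * Real.sqrt (l ^ 2 - (2 * π * ‖(w : EuclideanSpace ℝ (Fin 2))‖) ^ 2) / 144 - (l ^ 2 - (2 * π * ‖(w : EuclideanSpace ℝ (Fin 2))‖) ^ 2) ^ 4 * Real.sqrt (l ^ 2 - (2 * π * ‖(w : EuclideanSpace ℝ (Fin 2))‖) ^ 2) / 43545600) 0 / (1 + Real.exp (-(3 * l / 4)) / Real.sqrt (1 - Real.exp (-(3 * l / 2)))) ^ 2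
      - max (-((l ^ 2 - (2 * π * ‖(w : EuclideanSpace ℝ (Fin 2))‖) ^ 2) * Real.sqrt (l ^ 2 - (2 * π * ‖(w : EuclideanSpace ℝ (Fin 2))‖) ^ 2) / 144 - (l ^ 2 - (2 * π * ‖(w : EuclideanSpace ℝ (Fin 2))‖) ^ 2) ^ 4 * Real.sqrt (l ^ 2 - (2 * π * ‖(w : EuclideanSpace ℝ (Fin 2))‖) ^ 2) / 43545600)) 0 / (1 - Real.exp (-(3 * l / 4)) / Real.sqrt (1 - Real.exp (-(3 * l / 2)))) ^ 2)
      * (‖((Real.exp (-(l * c₂)) * (1 - Real.exp (-(2 * (l * c₁)))) : ℝ) : ℂ) * (∑ f ∈ F₂, Complex.exp (2 * π * Complex.I * (⟪f, (w : EuclideanSpace ℝ (Fin 2))⟫_ℝ : ℂ))) + ((Real.exp (-(2 * (l * c₂))) - Real.exp (-(2 * (l * c₁))) : ℝ) : ℂ) * (∑ f ∈ F₁, Complex.exp (2 * π * Complex.I * (⟪f, (w : EuclideanSpace ℝ (Fin 2))⟫_ℝ : ℂ))) - ((Real.exp (-(l * c₁)) * (1 - Real.exp (-(2 * (l * c₂))))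 : ℝ) : ℂ) * (∑ f ∈ F₀, Complex.exp (2 * π * Complex.I * (⟪f, (w : EuclideanSpace ℝ (Fin 2))⟫_ℝ : ℂ)))‖ ^ 2
      / ((1 - Real.exp (-(2 * (l * c₁)))) * (1 - Real.exp (-(2 * (l * c₂)))) ^ 2)))) →
      ∀ (Q : PeriodicConfiguration 3) (τu τd : ℝ → ℝ) (a b g₀ : EuclideanSpace ℝ (Fin 3))
      (z : ℤ → ℝ) (n : ℕ) (F : ℤ → Finset (EuclideanSpace ℝ (Fin 3)))
      (L : Submodule ℤ (EuclideanSpace ℝ (Fin 2))) [DiscreteTopology L] [IsZLattice ℝ L],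
      (∀ x ∈ Q.points, ∀ y ∈ Q.points, x ≠ y → (2 : ℝ) / 3 ≤ dist x y) →
      (∀ x' ∈ Q.points, ∀ y ∈ Q.points, x' 2 ≠ y 2 → (3 : ℝ) / 4 ≤ |x' 2 - y 2|) →
      (∀ t : ℝ, (∃ x ∈ Q.points, x 2 = t) →
      (t < τu t ∧ (∃ x ∈ Q.points, x 2 = τu t) ∧ (∀ x ∈ Q.points, x 2 ≤ t ∨ τu t ≤ x 2)) ∧
      (τd t < t ∧ (∃ x ∈ Q.points, x 2 = τd t) ∧ (∀ x ∈ Q.points, x 2 ≤ τd t ∨ t ≤ x 2))) →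
      a ∈ Q.lattice → b ∈ Q.lattice → a 2 = 0 → b 2 = 0 → LinearIndependent ℝ ![a, b] →
      (∀ g ∈ Q.lattice, g 2 = 0 → ∃ k l : ℤ, g = (k : ℝ) • a + (l : ℝ) • b) →
      (∀ v : EuclideanSpace ℝ (Fin 2),
      v ∈ L ↔ ∃ k l : ℤ, v = (k : ℝ) • !₂[a 0, a 1] + (l : ℝ) • !₂[b 0, b 1]) →
      g₀ ∈ Q.lattice → 0 < n → StrictMono z → (∀ i : ℤ, z (i + n) = z i + g₀ 2) →
      (∀ g ∈ Q.lattice, ∃ k : ℤ, g 2 = g₀ 2 * k) →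
      (∀ y ∈ Q.points, ∃ i : ℤ, y 2 = z i) → (∀ i : ℤ, ∃ y ∈ Q.points, y 2 = z i) →
      (∀ i : ℤ, z (i + 1) = τu (z i)) → (∀ i : ℤ, τd (z (i + 1)) = z i) →
      (∀ m : ℤ, ∀ f ∈ F m, f 2 = z m ∧ f ∈ Q.points) →
      (∀ m : ℤ, ∀ f ∈ F m, ∀ f' ∈ F m, f ≠ f' → ∀ k l : ℤ, f' ≠ f + (k : ℝ) • a + (l : ℝ) • b) →
      (∀ (m : ℤ) (y : EuclideanSpace ℝ (Fin 3)),
      (y ∈ Q.points ∧ y 2 = z m) ↔ ∃ f ∈ F m, ∃ k l : ℤ, y = f + (k : ℝ) • a + (l : ℝ) • b) →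
      (∀ m : ℤ, F (m + n) = (F m).image (fun f => f + g₀)) →
      0 ≤ ∑' w : dualLattice L, ∫ l in Set.Ioi (2 * π * ‖(w : EuclideanSpace ℝ (Fin 2))‖),
      ((l ^ 2 - (2 * π * ‖(w : EuclideanSpace ℝ (Fin 2))‖) ^ 2) * Real.sqrt (l ^ 2 - (2 * π * ‖(w : EuclideanSpace ℝ (Fin 2))‖) ^ 2) / 144 - (l ^ 2 - (2 * π * ‖(w : EuclideanSpace ℝ (Fin 2))‖) ^ 2) ^ 4 * Real.sqrt (l ^ 2 - (2 * π * ‖(w : EuclideanSpace ℝ (Fin 2))‖) ^ 2) / 43545600)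
      * ∑ i ∈ Finset.range n,
      ((2 * ((∑ f ∈ F ((i : ℤ)), Complex.exp (2 * π * Complex.I * (⟪(!₂[f 0, f 1] : EuclideanSpace ℝ (Fin 2)), (w : EuclideanSpace ℝ (Fin 2))⟫_ℝ : ℂ))) * starRingEnd ℂ (∑ f ∈ F ((i : ℤ) + 1), Complex.exp (2 * π * Complex.I * (⟪(!₂[f 0, f 1] : EuclideanSpace ℝ (Fin 2)), (w : EuclideanSpace ℝ (Fin 2))⟫_ℝ : ℂ)))).re
      * Real.exp (-(l * (z (((i : ℤ)) + 1) - z ((i : ℤ)))))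
      + (‖(∑ f ∈ F ((i : ℤ)), Complex.exp (2 * π * Complex.I * (⟪(!₂[f 0, f 1] : EuclideanSpace ℝ (Fin 2)), (w : EuclideanSpace ℝ (Fin 2))⟫_ℝ : ℂ)))‖ ^ 2 + ‖(∑ f ∈ F ((i : ℤ) + 1), Complex.exp (2 * π * Complex.I * (⟪(!₂[f 0, f 1] : EuclideanSpace ℝ (Fin 2)), (w : EuclideanSpace ℝ (Fin 2))⟫_ℝ : ℂ)))‖ ^ 2)
      * Real.exp (-(2 * (l * (z (((i : ℤ)) + 1) - z ((i : ℤ)))))))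
      / (1 - Real.exp (-(2 * (l * (z (((i : ℤ)) + 1) - z ((i : ℤ)))))))
      - 2 * ((∑ f ∈ F ((i : ℤ)), Complex.exp (2 * π * Complex.I * (⟪(!₂[f 0, f 1] : EuclideanSpace ℝ (Fin 2)), (w : EuclideanSpace ℝ (Fin 2))⟫_ℝ : ℂ))) * starRingEnd ℂ
      (∑' k : ℕ, (Real.exp (-(l * (z ((i : ℤ) + 1 + k) - z (i : ℤ)))) : ℂ)
      * (∑ f ∈ F ((i : ℤ) + 1 + (k : ℤ)), Complex.exp (2 * π * Complex.I * (⟪(!₂[f 0, f 1] : EuclideanSpace ℝ (Fin 2)), (w : EuclideanSpace ℝ (Fin 2))⟫_ℝ : ℂ))))).re))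
    (hC :
      ∀ (L : Submodule ℤ (EuclideanSpace ℝ (Fin 2))) [DiscreteTopology L] [IsZLattice ℝ L]
      (F₀ F₁ F₂ : Finset (EuclideanSpace ℝ (Fin 2))) (c₁ c₂ : ℝ),
      (∀ f ∈ F₀, ∀ f' ∈ F₀, ∀ v ∈ L, f ≠ f' + v → (2 : ℝ) / 3 ≤ dist f (f' + v)) →
      (∀ f ∈ F₁, ∀ f' ∈ F₁, ∀ v ∈ L, f ≠ f' + v → (2 : ℝ) / 3 ≤ dist f (f' + v)) →
      (∀ f ∈ F₂, ∀ f' ∈ F₂, ∀ v ∈ L, f ≠ f' + v → (2 : ℝ) / 3 ≤ dist f (f' + v)) →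
      (3 : ℝ) / 4 ≤ c₁ → (3 : ℝ) / 4 ≤ c₂ →
      0 ≤ (∑' w : dualLattice L, ∫ l in Set.Ioi (max (2 * π * ‖(w : EuclideanSpace ℝ (Fin 2))‖) (1 / 2 : ℝ)),
      (max ((l ^ 2 - (2 * π * ‖(w : EuclideanSpace ℝ (Fin 2))‖) ^ 2) * Real.sqrt (l ^ 2 - (2 * π * ‖(w : EuclideanSpace ℝ (Fin 2))‖) ^ 2) / 144 - (l ^ 2 - (2 * π * ‖(w : EuclideanSpace ℝ (Fin 2))‖) ^ 2) ^ 4 * Real.sqrt (l ^ 2 - (2 * π * ‖(w : EuclideanSpace ℝ (Fin 2))‖) ^ 2) / 43545600) 0 / (1 + Real.exp (-(3 * l / 4)) / Real.sqrt (1 - Real.exp (-(3 * l / 2)))) ^ 2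
      - max (-((l ^ 2 - (2 * π * ‖(w : EuclideanSpace ℝ (Fin 2))‖) ^ 2) * Real.sqrt (l ^ 2 - (2 * π * ‖(w : EuclideanSpace ℝ (Fin 2))‖) ^ 2) / 144 - (l ^ 2 - (2 * π * ‖(w : EuclideanSpace ℝ (Fin 2))‖) ^ 2) ^ 4 * Real.sqrt (l ^ 2 - (2 * π * ‖(w : EuclideanSpace ℝ (Fin 2))‖) ^ 2) / 43545600)) 0 / (1 - Real.exp (-(3 * l / 4)) / Real.sqrt (1 - Real.exp (-(3 * l / 2)))) ^ 2)
      * (‖((Real.exp (-(l * c₂)) * (1 - Real.exp (-(2 * (l * c₁)))) : ℝ) : ℂ) * (∑ f ∈ F₂, Complex.exp (2 * π * Complex.I * (⟪f, (w : EuclideanSpace ℝ (Fin 2))⟫_ℝ : ℂ))) + ((Real.exp (-(2 * (l * c₂))) - Real.exp (-(2 * (l * c₁))) : ℝ) : ℂ) * (∑ f ∈ F₁, Complex.exp (2 * π * Complex.I * (⟪f, (w : EuclideanSpace ℝ (Fin 2))⟫_ℝ : ℂ))) - ((Real.exp (-(l * c₁)) * (1 - Real.exp (-(2 * (l * c₂))))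 : ℝ) : ℂ) * (∑ f ∈ F₀, Complex.exp (2 * π * Complex.I * (⟪f, (w : EuclideanSpace ℝ (Fin 2))⟫_ℝ : ℂ)))‖ ^ 2
      / ((1 - Real.exp (-(2 * (l * c₁)))) * (1 - Real.exp (-(2 * (l * c₂)))) ^ 2))))

include hA hB hC

/-- The lead's open stub `stub_kernelFormNonneg` (kernel form `≥ 0`) from the three subs. -/
theorem kernelFormNonneg_of_subs :
    ∀ (Q : PeriodicConfiguration 3) (τu τd : ℝ → ℝ) (a b g₀ : EuclideanSpace ℝ (Fin 3))
      (z : ℤ → ℝ) (n : ℕ) (F : ℤ → Finset (EuclideanSpace ℝ (Fin 3)))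
      (L : Submodule ℤ (EuclideanSpace ℝ (Fin 2))) [DiscreteTopology L] [IsZLattice ℝ L],
      (∀ x ∈ Q.points, ∀ y ∈ Q.points, x ≠ y → (2 : ℝ) / 3 ≤ dist x y) →
      (∀ x' ∈ Q.points, ∀ y ∈ Q.points, x' 2 ≠ y 2 → (3 : ℝ) / 4 ≤ |x' 2 - y 2|) →
      (∀ t : ℝ, (∃ x ∈ Q.points, x 2 = t) →
        (t < τu t ∧ (∃ x ∈ Q.points, x 2 = τu t) ∧ (∀ x ∈ Q.points, x 2 ≤ t ∨ τu t ≤ x 2)) ∧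
        (τd t < t ∧ (∃ x ∈ Q.points, x 2 = τd t) ∧ (∀ x ∈ Q.points, x 2 ≤ τd t ∨ t ≤ x 2))) →
      a ∈ Q.lattice → b ∈ Q.lattice → a 2 = 0 → b 2 = 0 → LinearIndependent ℝ ![a, b] →
      (∀ g ∈ Q.lattice, g 2 = 0 → ∃ k l : ℤ, g = (k : ℝ) • a + (l : ℝ) • b) →
      (∀ v : EuclideanSpace ℝ (Fin 2),
        v ∈ L ↔ ∃ k l : ℤ, v = (k : ℝ) • !₂[a 0, a 1] + (l : ℝ) • !₂[b 0, b 1]) →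
      g₀ ∈ Q.lattice → 0 < n → StrictMono z → (∀ i : ℤ, z (i + n) = z i + g₀ 2) →
      (∀ g ∈ Q.lattice, ∃ k : ℤ, g 2 = g₀ 2 * k) →
      (∀ y ∈ Q.points, ∃ i : ℤ, y 2 = z i) → (∀ i : ℤ, ∃ y ∈ Q.points, y 2 = z i) →
      (∀ i : ℤ, z (i + 1) = τu (z i)) → (∀ i : ℤ, τd (z (i + 1)) = z i) →
      (∀ m : ℤ, ∀ f ∈ F m, f 2 = z m ∧ f ∈ Q.points) →
      (∀ m : ℤ, ∀ f ∈ F m, ∀ f' ∈ F m, f ≠ f' → ∀ k l : ℤ, f' ≠ f + (k : ℝ) • a + (l : ℝ) • b) →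
      (∀ (m : ℤ) (y : EuclideanSpace ℝ (Fin 3)),
        (y ∈ Q.points ∧ y 2 = z m) ↔ ∃ f ∈ F m, ∃ k l : ℤ, y = f + (k : ℝ) • a + (l : ℝ) • b) →
      (∀ m : ℤ, F (m + n) = (F m).image (fun f => f + g₀)) →
      0 ≤ ∑ i₀ ∈ Finset.range n, ∑ x ∈ F i₀,
        ∑ m ∈ Finset.range n, ∑ f' ∈ F m, ∑' v : L,
        ∑' j : ℤ,
          ((if (m : ℤ) + j * n = (i₀ : ℤ) then 0 else
              2 * lennardJones (Real.sqrt
                (‖!₂[x 0, x 1] - !₂[f' 0, f' 1] - (j : ℝ) • !₂[g₀ 0, g₀ 1]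
                    - (v : EuclideanSpace ℝ (Fin 2))‖ ^ 2 + (z (i₀ : ℤ) - z ((m : ℤ) + j * n)) ^ 2)))
            - (if (m : ℤ) + j * n = (i₀ : ℤ) then
                ∑' k : {k : ℤ // k ≠ 0},
                  (lennardJones (Real.sqrt
                      (‖!₂[x 0, x 1] - !₂[f' 0, f' 1] - (v : EuclideanSpace ℝ (Fin 2))‖ ^ 2
                        + (2 * |(k : ℝ)| * (z ((i₀ : ℤ) + 1) - z (i₀ : ℤ))) ^ 2)) +
                   lennardJones (Real.sqrt
                      (‖!₂[x 0, x 1] - !₂[f' 0, f' 1] - (v : EuclideanSpace ℝ (Fin 2))‖ ^ 2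
                        + (2 * |(k : ℝ)| * (z (i₀ : ℤ) - z ((i₀ : ℤ) - 1))) ^ 2)))
               else 0)
            - (if (m : ℤ) + j * n = (i₀ : ℤ) + 1 then
                ∑' k : ℤ, lennardJones (Real.sqrt
                  (‖!₂[x 0, x 1] - !₂[f' 0, f' 1] - (j : ℝ) • !₂[g₀ 0, g₀ 1]
                      - (v : EuclideanSpace ℝ (Fin 2))‖ ^ 2
                    + (|2 * (k : ℝ) + 1| * (z ((i₀ : ℤ) + 1) - z (i₀ : ℤ))) ^ 2))
               else 0)
            - (if (m : ℤ) + j * n = (i₀ : ℤ) - 1 then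
                ∑' k : ℤ, lennardJones (Real.sqrt
                  (‖!₂[x 0, x 1] - !₂[f' 0, f' 1] - (j : ℝ) • !₂[g₀ 0, g₀ 1]
                      - (v : EuclideanSpace ℝ (Fin 2))‖ ^ 2
                    + (|2 * (k : ℝ) + 1| * (z (i₀ : ℤ) - z ((i₀ : ℤ) - 1))) ^ 2))
               else 0)) := by
  intro Q τu τd a b g₀ z n F L _ _ hsep hgap Hτ ha hb ha2 hb2 hab hspan hLmem hg₀ hn hz hper hvert hcov
    hocc hzu hzd hFmem hFsep hFchar hFper
  rw [hA Q τu τd a b g₀ z n F L hsep hgap Hτ ha hb ha2 hb2 hab hspan hLmem hg₀ hn hz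
    hper hvert hcov hocc hzu hzd hFmem hFsep hFchar hFper]
  exact mul_nonneg (div_nonneg (by positivity) (ZLattice.covolume_pos L MeasureTheory.volume).le)
    (hB hC Q τu τd a b g₀ z n F L hsep hgap Hτ ha hb ha2 hb2
      hab hspan hLmem hg₀ hn hz hper hvert hcov hocc hzu hzd hFmem hFsep hFchar hFper)

/-- The per-site chessboard deficit inequality (the lead's `stub_deficitCore` shape, horizontal-basis lemma as a hypothesis)
from the three subs — the lead's v9 bookkeeping verbatim. -/
theorem deficitCore_of_subs :
    (∀ Q : PeriodicConfiguration 3,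
      (∃ c₀ : ℝ, 0 < c₀ ∧ (∃ g ∈ Q.lattice, g 2 = c₀) ∧ ∀ g ∈ Q.lattice, ∃ k : ℤ, g 2 = c₀ * k) →
      ∃ a ∈ Q.lattice, ∃ b ∈ Q.lattice, a 2 = 0 ∧ b 2 = 0 ∧ LinearIndependent ℝ ![a, b] ∧
        ∀ g ∈ Q.lattice, g 2 = 0 → ∃ k l : ℤ, g = (k : ℝ) • a + (l : ℝ) • b) →
    ∀ (Q : PeriodicConfiguration 3) (τu τd : ℝ → ℝ),
      (∀ x ∈ Q.points, ∀ y ∈ Q.points, x ≠ y → (2 : ℝ) / 3 ≤ dist x y) →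
      (∀ x ∈ Q.points, ∀ y ∈ Q.points, x 2 ≠ y 2 → (3 : ℝ) / 4 ≤ |x 2 - y 2|) →
      (∀ t : ℝ, (∃ x ∈ Q.points, x 2 = t) →
        (t < τu t ∧ (∃ x ∈ Q.points, x 2 = τu t) ∧ (∀ x ∈ Q.points, x 2 ≤ t ∨ τu t ≤ x 2)) ∧
        (τd t < t ∧ (∃ x ∈ Q.points, x 2 = τd t) ∧ (∀ x ∈ Q.points, x 2 ≤ τd t ∨ t ≤ x 2))) →
      0 ≤ ∑ x ∈ Q.motif,
        (2 * (∑' y : {y : EuclideanSpace ℝ (Fin 3) // y ∈ Q.points ∧ y ≠ x},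
                lennardJones (dist x y.1))
          - (∑' y : {y : EuclideanSpace ℝ (Fin 3) //
                y ∈ {p : EuclideanSpace ℝ (Fin 3) | ∃ k : ℤ, ∃ x' ∈ Q.points,
                  (x' 2 = x 2 ∨ x' 2 = τu (x 2)) ∧
                  p = x' + ((2 * (τu (x 2) - x 2)) * (k : ℝ)) •
                    EuclideanSpace.single (2 : Fin 3) (1 : ℝ)} ∧ y ≠ x},
                lennardJones (dist x y.1))
          - (∑' y : {y : EuclideanSpace ℝ (Fin 3) //
                y ∈ {p : EuclideanSpace ℝ (Fin 3) | ∃ k : ℤ, ∃ x' ∈ Q.points,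
                  (x' 2 = τd (x 2) ∨ x' 2 = x 2) ∧
                  p = x' + ((2 * (x 2 - τd (x 2))) * (k : ℝ)) •
                    EuclideanSpace.single (2 : Fin 3) (1 : ℝ)} ∧ y ≠ x},
                lennardJones (dist x y.1))) := by
  intro hHB Q τu τd hsep hgap Hτ
  classical
  obtain ⟨c₀, hc₀, ⟨g₀, hg₀, hg₀2⟩, hvert⟩ := stub_verticalPeriod Q hgap
  obtain ⟨a, ha, b, hb, ha2, hb2, hab, hspan⟩ := hHB Q ⟨c₀, hc₀, ⟨g₀, hg₀, hg₀2⟩, hvert⟩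
  obtain ⟨n, z, hn, hz, hzu, hzd, hper, hocc, hcov⟩ :=
    heightEnumeration Q τu τd c₀ hgap Hτ hc₀ ⟨g₀, hg₀, hg₀2⟩ hvert
  have hper' : ∀ i : ℤ, z (i + n) = z i + g₀ 2 := fun i => by rw [hg₀2]; exact hper i
  have hvert' : ∀ g ∈ Q.lattice, ∃ k : ℤ, g 2 = g₀ 2 * k := fun g hg => by
    rw [hg₀2]; exact hvert g hg
  have hcov' : ∀ y ∈ Q.points, ∃ i : ℤ, y 2 = z i := fun y hy => by
    obtain ⟨i, hi⟩ := hcov (y 2) ⟨y, hy, rfl⟩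
    exact ⟨i, hi.symm⟩
  obtain ⟨F, _hFcard, hFmem, hFsep, hFchar, hFper⟩ :=
    layerPresentation_periodic Q a b g₀ z n ha hb ha2 hb2 hab hspan hg₀ hn hz hper' hcov'
  obtain ⟨L, hLd, hLz, hLmem⟩ := planarLattice a b ha2 hb2 hab
  haveI : DiscreteTopology L := hLd
  haveI : IsZLattice ℝ L := hLz
  rw [deficit_motif_to_layers Q τu τd a b g₀ z n F Hτ ha hb ha2 hb2 hspan hg₀ hn hz hper' hvert'
    hcov' hFmem hFsep hFchar hFper]
  rw [Finset.sum_congr rfl fun i₀ hi₀ => Finset.sum_congr rfl fun x hx =>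
    deficitSite_kernelForm Q τu τd a b g₀ z n F L i₀ x hgap ha hb ha2 hb2 hab hLmem hg₀ hn hz hper'
      hcov' hocc hzu hzd hFmem hFsep hFchar hFper (Finset.mem_range.1 hi₀) hx]
  exact kernelFormNonneg_of_subs hA hB hC Q τu τd a b g₀ z n F L hsep hgap Hτ ha hb ha2 hb2 hab hspan hLmem hg₀ hn hz
    hper' hvert' hcov' hocc hzu hzd hFmem hFsep hFchar hFper

/-- **GLUE of the split (sorry-free): sub A → sub B → sub C → the crux `LjPlaneChessboard` BY NAME**, via the landed
reduction `stub_reduction` (p113745) and the landed horizontal-basis lemma `stub_horizontalBasis` (p127668). -/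
theorem ljPlaneChessboard_of_subs :
    Summit.AtomisticToContinuum.Crystallization.Theses.ChessboardParticlePlanes.LjPlaneChessboard :=
  stub_reduction (deficitCore_of_subs hA hB hC stub_horizontalBasis)

end Subs

end Summit.AtomisticToContinuum.Crystallization.Theorems.ChessboardParticlePlanesLjPlaneChessboard

end
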